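import Summits.MatrixMultiplication.MatrixMultiplication.Theorems.ObstructionDescentUniversalOccurrenceTwoRectangleBlowUpDirectSum

set_option linter.dupNamespace false
set_option autoImplicit false

/-!
# Obstruction descent — universal occurrence: invariance laws of the blow-up determinant (K35)

Lens-3 node g45, the elementary transformation laws behind the storey dictionary (K33 `…BlowUpGadget`,
K34 `…BlowUpDirectSum`).  For a slice family `T = (T_l)_l` (square, any index type `ι`) and a tuple
`X = (X_l)_l` of `δ × δ` matrices put `F(X,T) = det(∑_l X_l ⊗ T_l)`.  Proved here, sorry-free and
`def`-free, over any commutative ring: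

* `blowUp_det_conj` — semi-invariance in the matrix variables:
  `F((g X_l h)_l, T) = det(g)^{|ι|} det(h)^{|ι|} F(X,T)` for ALL square `g, h` (so `F(·,T)` is an
  `SL_δ × SL_δ`-invariant polynomial in `X`; for `δ = 2` an `SO₄`-invariant of the tuple `X ∈ (Mat₂,det)^n`);
* `blowUp_det_transpose` — blockwise transposition of `X` is transposition of the slices:
  `F((X_lᵀ)_l, T) = F(X, (T_lᵀ)_l)`, i.e. `D_t(Xᵀ) = D_{t'}(X)` with `t'` the tensor with its first two legs
  swapped — the improper isometry of the dictionary is the `U ↔ V` symmetry of the tensor;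
* `blowUp_sum_kronecker_relabel` — change of basis in the third leg moves to the matrix variables:
  `∑_l X_l ⊗ (∑_{l'} g_{l l'} T_{l'}) = ∑_{l'} (∑_l g_{l l'} X_l) ⊗ T_{l'}`, whence
  `blowUp_det_relabel`: `F(X, g·T) = F(gᵀ·X, T)` — the `GL(W)`-equivariance that makes the `GL(W)`-types of
  `span_t F(·,t)` (polynomials in `X`) and of `span_X F(X,·)` (functions of `t`, the two-rectangle sector) agree.

With K25 (`det_sum_kronecker_slice_actTensor₁₂`: `(det^δ, det^δ)`-semi-invariance in `t`) these are all the
transformation laws the dictionary uses.  References: Bürgisser–Ikenmeyer 2011 §4–6; Domokos–Zubkov 2001;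
Goodman–Wallach Thm 5.7.3; Fulton–Harris p. 142 (`SL₂ × SL₂ → SO₄`, `A ↦ g A h⁻¹`).
-/

namespace Summit.MatrixMultiplication.MatrixMultiplication.Theorems.ObstructionCalculus

open Matrix BigOperators
open scoped Kronecker

section Invariance

variable {R : Type*} [CommRing R] {ι : Type*} [Fintype ι] [DecidableEq ι] {δ n n' : ℕ}

/-- **Semi-invariance in the matrix variables.**  `det(∑_l (g X_l h) ⊗ T_l) = det(g)^{|ι|} det(h)^{|ι|} det(∑_l X_l ⊗ T_l)`
for all square `g, h` (no invertibility needed). [folklore; this node] -/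
theorem blowUp_det_conj (g h : Matrix (Fin δ) (Fin δ) R) (X : Fin n → Matrix (Fin δ) (Fin δ) R)
    (T : Fin n → Matrix ι ι R) :
    (∑ l, (g * X l * h) ⊗ₖ T l).det =
      g.det ^ Fintype.card ι * h.det ^ Fintype.card ι * (∑ l, X l ⊗ₖ T l).det := by
  have hl : ∀ l, (g * X l * h) ⊗ₖ T l =
      (g ⊗ₖ (1 : Matrix ι ι R)) * (X l ⊗ₖ T l) * (h ⊗ₖ (1 : Matrix ι ι R)) := by
    intro l
    rw [← Matrix.mul_kronecker_mul, ← Matrix.mul_kronecker_mul, Matrix.one_mul, Matrix.mul_one]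
  have hsum : ∑ l, (g * X l * h) ⊗ₖ T l =
      (g ⊗ₖ (1 : Matrix ι ι R)) * (∑ l, X l ⊗ₖ T l) * (h ⊗ₖ (1 : Matrix ι ι R)) := by
    simp_rw [hl]
    rw [Finset.mul_sum, Finset.sum_mul]
  rw [hsum, Matrix.det_mul, Matrix.det_mul, Matrix.det_kronecker, Matrix.det_kronecker]
  simp only [Matrix.det_one, one_pow, mul_one]
  ring

/-- In particular `F(·,T)` is invariant under `X_l ↦ g X_l h` with `det g = det h = 1`
(`SL_δ × SL_δ`; for `δ = 2`: `SO₄` acting on `(Mat₂, det)`). [folklore; this node] -/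
theorem blowUp_det_conj_of_det_eq_one (g h : Matrix (Fin δ) (Fin δ) R) (hg : g.det = 1) (hh : h.det = 1)
    (X : Fin n → Matrix (Fin δ) (Fin δ) R) (T : Fin n → Matrix ι ι R) :
    (∑ l, (g * X l * h) ⊗ₖ T l).det = (∑ l, X l ⊗ₖ T l).det := by
  rw [blowUp_det_conj, hg, hh, one_pow, one_mul, one_mul]

/-- **Blockwise transposition = swapping the first two legs.**
`det(∑_l X_lᵀ ⊗ T_l) = det(∑_l X_l ⊗ T_lᵀ)`. [this node] -/
theorem blowUp_det_transpose (X : Fin n → Matrix (Fin δ) (Fin δ) R) (T : Fin n → Matrix ι ι R) :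
    (∑ l, (X l)ᵀ ⊗ₖ T l).det = (∑ l, X l ⊗ₖ (T l)ᵀ).det := by
  have h : ∑ l, (X l)ᵀ ⊗ₖ T l = (∑ l, X l ⊗ₖ (T l)ᵀ)ᵀ := by
    rw [Matrix.transpose_sum]
    refine Finset.sum_congr rfl fun l _ => ?_
    rw [← Matrix.kroneckerMap_transpose, Matrix.transpose_transpose]
  rw [h, Matrix.det_transpose]

omit [Fintype ι] [DecidableEq ι] in
/-- **Change of basis in the third leg moves to the matrix variables.**
`∑_l X_l ⊗ (∑_{l'} g_{l l'} T_{l'}) = ∑_{l'} (∑_l g_{l l'} X_l) ⊗ T_{l'}`. [this node] -/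
theorem blowUp_sum_kronecker_relabel (g : Matrix (Fin n) (Fin n') R) (X : Fin n → Matrix (Fin δ) (Fin δ) R)
    (T : Fin n' → Matrix ι ι R) :
    ∑ l, X l ⊗ₖ (∑ l', g l l' • T l') = ∑ l', (∑ l, g l l' • X l) ⊗ₖ T l' := by
  ext ⟨a, i⟩ ⟨b, j⟩
  simp only [Matrix.sum_apply, Matrix.kroneckerMap_apply, Matrix.smul_apply, smul_eq_mul,
    Finset.mul_sum, Finset.sum_mul]
  rw [Finset.sum_comm]
  refine Finset.sum_congr rfl fun l' _ => Finset.sum_congr rfl fun l _ => ?_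
  ring

/-- Hence `F(X, g·T) = F(gᵀ·X, T)`: the `GL(W)`-action on the third leg of the tensor is the (transposed)
`GL(W)`-action on the tuple of matrix variables. [this node] -/
theorem blowUp_det_relabel (g : Matrix (Fin n) (Fin n') R) (X : Fin n → Matrix (Fin δ) (Fin δ) R)
    (T : Fin n' → Matrix ι ι R) :
    (∑ l, X l ⊗ₖ (∑ l', g l l' • T l')).det = (∑ l', (∑ l, g l l' • X l) ⊗ₖ T l').det := by
  rw [blowUp_sum_kronecker_relabel]

/-- The antisymmetric part under blockwise transposition (the four-odd part of the dictionary) is itself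
semi-invariant: `(F(gXh,T) − F((gXh)ᵀ,T)) = det(g)^{|ι|} det(h)^{|ι|} (F(X,T) − F(Xᵀ,T))`, using
`(g X h)ᵀ = hᵀ Xᵀ gᵀ`. [this node] -/
theorem blowUp_det_sub_det_transpose_conj (g h : Matrix (Fin δ) (Fin δ) R)
    (X : Fin n → Matrix (Fin δ) (Fin δ) R) (T : Fin n → Matrix ι ι R) :
    (∑ l, (g * X l * h) ⊗ₖ T l).det - (∑ l, (g * X l * h)ᵀ ⊗ₖ T l).det =
      g.det ^ Fintype.card ι * h.det ^ Fintype.card ι *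
        ((∑ l, X l ⊗ₖ T l).det - (∑ l, (X l)ᵀ ⊗ₖ T l).det) := by
  have ht : ∀ l, (g * X l * h)ᵀ = hᵀ * (X l)ᵀ * gᵀ := by
    intro l
    rw [Matrix.transpose_mul, Matrix.transpose_mul, Matrix.mul_assoc]
  simp_rw [ht]
  rw [blowUp_det_conj, blowUp_det_conj hᵀ gᵀ, Matrix.det_transpose, Matrix.det_transpose]
  ring

end Invariance

end Summit.MatrixMultiplication.MatrixMultiplication.Theorems.ObstructionCalculus
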